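import Literature.Computability.MetaComplexity.NoRefuterFormat
import Literature.Computability.MetaComplexity.ConstructiveSeparations
import Literature.Computability.Complexity.ExpTimeMaps
import HarnessLib

/-!
# Hard `NP` languages without refuters (Chen–Jin–Santhanam–Williams, Thm. 1.9): decoding and search

Topic `Literature/Computability/MetaComplexity`. Second proof file of the corrected form of
[ChenEtAl2022, Thm. 1.9, first part] (hypothesis `NE ⊄ io-E`; to be assembled in a later file of the
series, `ConstructiveSeparationsProofs.lean`), continuing `NoRefuterFormat.lean` (the `NP` language
`B T V p D`, its query language `Hq`, certified tables `TableOK`, properties (S1)–(S4)). Everything is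
assembled from the tree's brick algebra (`BrickAlgebra.lean`, `PlumbingBricks.lean`,
`FPStringBricks.lean`, `ExpTimeMaps.lean`); no machine is programmed and no named fact is introduced
(proof devices in namespace `NoRefuter`).

## Contents

* §E–F (**the last step of the printed proof, with its conclusion as proved**): a `P`-refuter for `B`
  against the constant-one algorithm prints, for infinitely many `n`, an `n`-bit non-member of `B`;
  such `n` are canonical, and at a canonical length `canon D m` a non-member reveals level `m` of `T`
  (S3), so the `2^{O(n)}`-time decoder `DecLang` (pad the input `x` by `lpad (2D)`, run the refuter at
  length `canon D |x|`, read bit `⟦x⟧`) agrees with the language `L'` tally-coded by `T` on `{0,1}ᵐ` for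
  infinitely many `m`: **`mem_io_E_of_isPRefuter : L' ∈ io-E`** (not `L' ∈ E`: the refuter is only
  correct infinitely often).
* §G1–G3 (towards Claim 1, "`L̄ ∈ P ⇒` the certified tables are computable"): the mathematical model of
  the search — one step `stepFn` of the prefix search for a witness of `1ᴺ ∈ T`, its correctness
  `validW_iterate_stepFn`, the entries `entryOf N` and model tables `esOf ℓ` with `tableOK_esOf` — the
  oracle embedding `embedF` (a query next to a table, zero-padded to the canonical length, so that a
  decider of the oracle language `O` answers "`q ∈ Hq`?" whenever `O` satisfies `OracleOK`, which (S2)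
  says `B` does), and the inner counted loop `loopI` (`Brick.loopStep`) performing the prefix search,
  with its semantics `loopModel_bodyI`. The middle and outer loops (all words of a level; all levels)
  and the conclusion `L' ∈ E` follow in the next file of the series (`NoRefuterLevels.lean`).

## References

* L. Chen, C. Jin, R. Santhanam, R. Williams, *Constructive separations and their consequences*,
  FOCS 2021 / TheoretiCS 3 (2024), Thm. 1.9 and §6 (Proof of Thm. 1.9, Claim 1). [ChenEtAl2022]
* S. Arora, B. Barak, *Computational Complexity: A Modern Approach*, CUP 2009, §1.3 (bounded loops,
  composition), §2.1 (verifiers), §2.6.2 (padding). [AroraBarak2009]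
-/

noncomputable section

namespace Literature.Computability.MetaComplexity

open _root_.Computability Polynomial Complexity Brick Plumb Nondeterministic

namespace NoRefuter

/-! ### E. Padded inputs: the ruler, the canonical tally word and the index of a payload -/

section Padded

variable (D : ℕ)

/-- The ruler `w ↦ 1^{|w| + 2ᴰ}` of a padded input `w = lpad (2D) x`: at least `canon D |x|` long.
[folklore] -/
def rulerFn : List Bool → List Bool := polyFn (X + Polynomial.C (2 ^ D))

/-- `rulerFn D ∈ FP`. [folklore] -/
theorem rulerFn_mem_FP : rulerFn D ∈ FP := polyFn_mem_FP _

/-- Value of the ruler. [folklore] -/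
@[simp] theorem rulerFn_apply (w : List Bool) : rulerFn D w = ones (w.length + 2 ^ D) := by
  simp [rulerFn]

variable {D} in
/-- **The ruler is long enough**: `canon D |x| ≤ |lpad (2D) x| + 2ᴰ`. [folklore] -/
theorem canon_le_ruler (x : List Bool) : canon D x.length ≤ (lpad (2 * D) x).length + 2 ^ D := by
  rcases Nat.eq_zero_or_pos x.length with h | h
  · rw [canon, h]; simp
  · have h1 := two_pow_le_length_lpad (2 * D) x
    have h2 : canon D x.length ≤ 2 ^ (2 * D * x.length) :=
      Nat.pow_le_pow_right two_pos (by nlinarith)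
    exact h2.trans (h1.trans (Nat.le_add_right _ _))

/-- The canonical tally word of the payload's level: `w ↦ 1^{canon D |snd w|}` (the numeral `0^{D(|x|+1)} 1`
of `2^{D(|x|+1)}` converted to unary against the ruler). [folklore] -/
def canonOnesFn : List Bool → List Bool :=
  binToUnaryFn ∘ fanoutFn (rulerFn D) (AvgNE.pow2NumF D ∘ fun w => sndF w ++ [true])

/-- `canonOnesFn D ∈ FP`. [folklore] -/
theorem canonOnesFn_mem_FP : canonOnesFn D ∈ FP :=
  comp_mem_FP binToUnaryFn_mem_FP (fanoutFn_mem_FP (rulerFn_mem_FP D)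
    (comp_mem_FP (AvgNE.pow2NumF_mem_FP D) (append_mem_FP sndF_mem_FP (const_mem_FP _))))

/-- `sndF (lpad a x) = x` (the payload). [folklore] -/
@[simp] theorem sndF_lpad (a : ℕ) (x : List Bool) : sndF (lpad a x) = x := boolUnpair_lpad_snd a x

variable {D} in
/-- **Value of the canonical tally word on a padded input**: `1^{canon D |x|}`. [folklore] -/
theorem canonOnesFn_lpad (x : List Bool) : canonOnesFn D (lpad (2 * D) x) = ones (canon D x.length) := by
  have h := canon_le_ruler (D := D) x
  simp only [canonOnesFn, Function.comp_apply, fanoutFn_apply, binToUnaryFn_boolPair, AvgNE.bitsToNat_pow2NumF,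
    sndF_lpad, List.length_append, List.length_singleton, rulerFn_apply, List.length_replicate]
  rw [min_eq_left (by simpa [canon] using h)]
  rfl

/-- The index of the payload within its level, in unary: `w ↦ 1^{⟦snd w⟧}` (against the ruler). [folklore] -/
def idxOnesFn : List Bool → List Bool := binToUnaryFn ∘ fanoutFn (rulerFn D) sndF

/-- `idxOnesFn D ∈ FP`. [folklore] -/
theorem idxOnesFn_mem_FP : idxOnesFn D ∈ FP :=
  comp_mem_FP binToUnaryFn_mem_FP (fanoutFn_mem_FP (rulerFn_mem_FP D) sndF_mem_FP)

variable {D} in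
/-- **Value of the index on a padded input**: `1^{⟦x⟧}` (`⟦x⟧ < 2^{|x|} ≤ canon D |x| ≤` ruler). [folklore] -/
theorem idxOnesFn_lpad (hD : 0 < D) (x : List Bool) : idxOnesFn D (lpad (2 * D) x) = ones (bitsToNat x) := by
  have h := canon_le_ruler (D := D) x
  have h1 : bitsToNat x < 2 ^ x.length := bitsToNat_lt x
  have h2 : 2 ^ x.length ≤ canon D x.length := two_pow_le_canon hD _
  simp only [idxOnesFn, Function.comp_apply, fanoutFn_apply, binToUnaryFn_boolPair, sndF_lpad, rulerFn_apply,
    List.length_replicate]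
  rw [min_eq_left (by omega)]

end Padded

/-! ### F. A refuter against the constant-one algorithm decodes `L'` at infinitely many lengths -/

section Decode

variable {T V : Language Bool} {p : Polynomial ℕ} {D : ℕ}

/-- **A `P`-refuter is a polynomial-time STRING function of `1ⁿ`**: `w ↦ R |w|` is in `FP` (the
refuter's machine composed with `w ↦ 1^{|w|}`, `TimeComputable.comp_holds`). [cite: ChenEtAl2022, Def. 1.1] -/
theorem refuterFn_mem_FP {R : ℕ → List Bool} (hR : PolyTimeComputable unaryEncodeNat (id : List Bool → List Bool) R) :
    (fun w : List Bool => R w.length) ∈ FP := by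
  have h1 : PolyTimeComputable (id : List Bool → List Bool) unaryEncodeNat List.length := onesFn_mem_FP
  exact PolyTimeComputable.comp_holds hR h1

variable (D) in
/-- **The decoder**: on a padded input `w = lpad (2D) x`, run the refuter at the canonical length of
level `|x|` and read bit `⟦x⟧` of the table it printed. [cite: ChenEtAl2022, §6 (Proof of Thm. 1.9: "we can use this refuter to decide L' on m-bit inputs in 2^{O(m)} time")] -/
def decodeFn (R : ℕ → List Bool) : List Bool → List Bool :=
  fstF ∘ HashBricks.nthItemFn ∘ fanoutFn (idxOnesFn D) (fstF ∘ (fun w : List Bool => R w.length) ∘ canonOnesFn D)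

/-- `decodeFn D R ∈ FP`. [cite: AroraBarak2009, §1.3] -/
theorem decodeFn_mem_FP {R : ℕ → List Bool} (hR : PolyTimeComputable unaryEncodeNat (id : List Bool → List Bool) R) :
    decodeFn D R ∈ FP :=
  comp_mem_FP fstF_mem_FP (comp_mem_FP HashBricks.nthItemFn_mem_FP (fanoutFn_mem_FP (idxOnesFn_mem_FP D)
    (comp_mem_FP fstF_mem_FP (comp_mem_FP (refuterFn_mem_FP hR) (canonOnesFn_mem_FP D)))))

/-- **Value of the decoder on a padded input**: bit `⟦x⟧` of the refuter's output at length `canon D |x|`.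
[folklore] -/
theorem decodeFn_lpad (hD : 0 < D) (R : ℕ → List Bool) (x : List Bool) :
    decodeFn D R (lpad (2 * D) x) = readBit (R (canon D x.length)) (bitsToNat x) := by
  simp only [decodeFn, Function.comp_apply, fanoutFn_apply, idxOnesFn_lpad hD, canonOnesFn_lpad, List.length_replicate,
    readBit]

variable (D) in
/-- The language decided by the decoder: `{x | decodeFn (lpad (2D) x) = [1]}`. [folklore] -/
def DecLang (R : ℕ → List Bool) : Language Bool :=
  lpad (2 * D) ⁻¹' ({w | decodeFn D R w = (fun _ => [true]) w} : Language Bool)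

/-- **The decoder runs in time `2^{O(n)}`**: `DecLang ∈ E` (an `FE` pad followed by a `P` test,
`preimage_mem_E`). [cite: ChenEtAl2022, §6 (Proof of Thm. 1.9)] -/
theorem DecLang_mem_E {R : ℕ → List Bool} (hR : PolyTimeComputable unaryEncodeNat (id : List Bool → List Bool) R) :
    DecLang D R ∈ E :=
  preimage_mem_E (lpad_mem_FE _) (setOf_apply_eq_apply_mem_P (decodeFn_mem_FP hR) (const_mem_FP _))

/-- Membership in `DecLang`. [folklore] -/
theorem mem_DecLang (hD : 0 < D) (R : ℕ → List Bool) (x : List Bool) :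
    x ∈ DecLang D R ↔ readBit (R (canon D x.length)) (bitsToNat x) = [true] := by
  rw [DecLang, memL_preimage, ← decodeFn_lpad hD]
  exact Iff.rfl

/-- **At a level where the refuter succeeds, the decoder is correct.** If `|R n| = n`, `R n ∉ B` and
`n = canon D m`, then on `{0,1}ᵐ` the language `DecLang` is `L'` (the language tally-coded by `T`:
`x ∈ L' ↔ 1^{⟦x⟧ + 2^{|x|}} ∈ T`). [cite: ChenEtAl2022, §6 (Proof of Thm. 1.9)] -/
theorem decLang_correct (hD : 0 < D) (hver : IsPolyVerifierFor V p T) {L' : Language Bool}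
    (hL' : ∀ x, x ∈ L' ↔ ones (bitsToNat x + 2 ^ x.length) ∈ T) {R : ℕ → List Bool} {m : ℕ}
    (hlen : (R (canon D m)).length = canon D m) (hB : R (canon D m) ∉ B T V p D) (x : List Bool) (hx : x.length = m) :
    x ∈ L' ↔ x ∈ DecLang D R := by
  rw [mem_DecLang hD, hx, readBit_iff_of_not_mem_B hD hver hlen hB (by rw [← hx]; exact bitsToNat_lt x), hL', hx,
    Nat.add_comm]

/-- **A refuter for `B` against the constant-one algorithm puts `L'` in `io-E`.** The refuter prints,
for infinitely many `n`, an `n`-bit NON-member of `B`; such an `n` is canonical (non-canonical lengths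
are in `B`), say `n = canon D m`, and then `DecLang ∈ E` agrees with `L'` on `{0,1}ᵐ`; the levels `m` so
obtained are unbounded. This is the last step of the printed proof, with its conclusion as proved:
`L' ∈ io-E` (not `L' ∈ E`). [cite: ChenEtAl2022, §6 (Proof of Thm. 1.9)] -/
theorem mem_io_E_of_isPRefuter (hD : 0 < D) (hver : IsPolyVerifierFor V p T) {L' : Language Bool}
    (hL' : ∀ x, x ∈ L' ↔ ones (bitsToNat x + 2 ^ x.length) ∈ T) {R : ℕ → List Bool}
    (hR : IsPRefuter (B T V p D) (Set.univ : Set (List Bool)) R) : L' ∈ io E := by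
  obtain ⟨hRpoly, hio⟩ := hR
  refine ⟨DecLang D R, DecLang_mem_E hRpoly, ?_⟩
  rw [Filter.frequently_atTop] at hio ⊢
  intro a
  obtain ⟨n, hn, hlen, hB⟩ := hio (canon D a)
  have hB' : R n ∉ B T V p D := fun h => (hB.1 h) (Set.mem_univ _)
  have hcan : R n ∈ Canon D := by
    by_contra h
    exact hB' ((mem_B _ _ _ _ _).2 (Or.inl h))
  have hn' := length_eq_canon_of_mem_Canon hcan
  rw [hlen] at hn'
  set m := lvl D n with hm
  refine ⟨m, ?_, fun x hx => ?_⟩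
  · by_contra hlt
    push Not at hlt
    have := canon_strictMono hD hlt
    omega
  · rw [hn'] at hlen hB'
    exact decLang_correct hD hver hL' hlen hB' x hx

end Decode

/-! ### G. Claim 1: if `B ∈ P` then `L' ∈ E` — the certified tables can be COMPUTED level by level

The algorithm of [ChenEtAl2022, §6, Proof of Claim 1] with `SAT` replaced by the self-reduction queries
`Hq` of `T`: given the certified table `Tab_ℓ` of level `ℓ`, the polynomial-time decider of `B` on the
padded input `⟨Tab_ℓ, ⟨q, 0…0⟩⟩` of length `canon D ℓ` answers "`q ∈ Hq`?" (S2), i.e. "does the prefix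
`u` extend to a witness of `1ᴺ ∈ T`?", so the entries of level `ℓ + 1` (bits AND witnesses) are found by
prefix search; three nested counted loops (`Brick.loopStep`; inner: prefix search, middle: the `2^{ℓ+1}`
words of level `ℓ+1`, outer: levels `1 … m`), all clocked by a ruler of length `≥ canon D m`. -/

section Search

variable (V : Language Bool) (p : Polynomial ℕ) (D : ℕ) (O : Language Bool)

/-! #### G1. The mathematical model: prefix search and the tables `esOf ℓ` -/

/-- `u` extends to a witness of `1ᴺ ∈ T`. [folklore] -/
def Ext (N : ℕ) (u : List Bool) : Prop := ∃ v, ValidW V p N (u ++ v)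

open Classical in
/-- One step of the prefix search: extend by `0` if possible, else by `1` if possible, else stop.
[cite: ChenEtAl2022, §6 (Proof of Thm. 1.9, Claim 1: "a search-to-decision reduction")] -/
def stepFn (N : ℕ) (u : List Bool) : List Bool :=
  if Ext V p N (u ++ [false]) then u ++ [false] else if Ext V p N (u ++ [true]) then u ++ [true] else u

variable {V p D O}

/-- The search keeps extendable prefixes extendable. [folklore] -/
theorem ext_stepFn {N : ℕ} {u : List Bool} (h : Ext V p N u) : Ext V p N (stepFn V p N u) := by
  unfold stepFn
  split_ifs with h0 h1
  · exact h0
  · exact h1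
  · exact h

/-- Each step appends at most one symbol. [folklore] -/
theorem length_stepFn_le (N : ℕ) (u : List Bool) : (stepFn V p N u).length ≤ u.length + 1 := by
  unfold stepFn; split_ifs <;> simp

/-- Iterated steps grow the prefix by at most the number of steps. [folklore] -/
theorem length_iterate_stepFn_le (N : ℕ) : ∀ (k : ℕ) (u : List Bool), ((stepFn V p N)^[k] u).length ≤ u.length + k
  | 0, u => by simp
  | k + 1, u => by
    rw [Function.iterate_succ_apply']
    have := length_iterate_stepFn_le N k u
    have := length_stepFn_le (V := V) (p := p) N ((stepFn V p N)^[k] u)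
    omega

/-- A step either stops or appends exactly one symbol. [folklore] -/
theorem stepFn_eq_self_or (N : ℕ) (u : List Bool) :
    stepFn V p N u = u ∨ (stepFn V p N u).length = u.length + 1 := by
  unfold stepFn; split_ifs <;> simp

/-- A stuck extendable prefix is a witness. [folklore] -/
theorem validW_of_stepFn_eq {N : ℕ} {u : List Bool} (h : Ext V p N u) (hs : stepFn V p N u = u) : ValidW V p N u := by
  obtain ⟨v, hv⟩ := h
  cases v with
  | nil => simpa using hv
  | cons b v =>
    exfalso
    unfold stepFn at hs
    split_ifs at hs with h0 h1
    · simpa using congrArg List.length hs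
    · simpa using congrArg List.length hs
    · cases b with
      | false => exact h0 ⟨v, by simpa using hv⟩
      | true => exact h1 ⟨v, by simpa using hv⟩

/-- Once stuck, stuck forever. [folklore] -/
theorem iterate_stepFn_of_eq {N : ℕ} {u : List Bool} (hs : stepFn V p N u = u) (k : ℕ) : (stepFn V p N)^[k] u = u :=
  Function.iterate_fixed hs k

/-- **The prefix search finds a witness**: from the empty prefix, if `1ᴺ ∈ T` (i.e. `Ext N ε`), any
`k > p N` steps end at a valid witness. [cite: ChenEtAl2022, §6 (Proof of Thm. 1.9, Claim 1)] -/
theorem validW_iterate_stepFn {N k : ℕ} (h : Ext V p N []) (hk : p.eval N < k) :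
    ValidW V p N ((stepFn V p N)^[k] []) := by
  -- either some iterate is a fixed point, or the length grows by one at every step
  by_contra hne
  have key : ∀ i ≤ k, ((stepFn V p N)^[i] []).length = i ∧ Ext V p N ((stepFn V p N)^[i] []) := by
    intro i
    induction i with
    | zero => intro; exact ⟨rfl, h⟩
    | succ i ih =>
      intro hi
      obtain ⟨hl, he⟩ := ih (by omega)
      refine ⟨?_, by rw [Function.iterate_succ_apply']; exact ext_stepFn he⟩
      rw [Function.iterate_succ_apply']
      rcases stepFn_eq_self_or (V := V) (p := p) N ((stepFn V p N)^[i] []) with hfix | hlen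
      · -- stuck: the iterate is a witness, and it is also the final iterate
        exfalso
        have hval := validW_of_stepFn_eq he hfix
        have hk' : (stepFn V p N)^[k] [] = (stepFn V p N)^[i] [] := by
          rw [← iterate_stepFn_of_eq hfix (k - i), ← Function.iterate_add_apply, Nat.sub_add_cancel (by omega)]
        exact hne (hk' ▸ hval)
      · rw [hlen, hl]
  obtain ⟨hl, he⟩ := key k le_rfl
  obtain ⟨v, hv⟩ := he
  have := hv.1
  rw [List.length_append, hl] at this
  omega

variable (V p)

open Classical in
/-- **The entry of the tally word `1ᴺ`**: `⟨[1], the witness found by the search⟩` if `1ᴺ ∈ T`, else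
`⟨[0], ε⟩`. [cite: ChenEtAl2022, §6 (Proof of Thm. 1.9: the certified truth table)] -/
def entryOf (N : ℕ) : List Bool :=
  if Ext V p N [] then boolPair [true] ((stepFn V p N)^[p.eval N + 1] []) else boolPair [false] []

/-- **The entries of level `ℓ`**: those of `1^{2^ℓ + j}`, `j < 2^ℓ`. [folklore] -/
def esOf (ℓ : ℕ) : List (List Bool) := (List.range (2 ^ ℓ)).map fun j => entryOf V p (2 ^ ℓ + j)

variable {V p}

/-- Size of an entry: `|entryOf N| ≤ p N + 4`. [folklore] -/
theorem length_entryOf_le (N : ℕ) : (entryOf V p N).length ≤ p.eval N + 4 := by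
  unfold entryOf
  split_ifs with h
  · have := (validW_iterate_stepFn h (k := p.eval N + 1) (by omega)).1
    simp only [length_boolPair, List.length_singleton]
    omega
  · simp

/-- `|esOf ℓ| = 2^ℓ`. [folklore] -/
@[simp] theorem length_esOf (ℓ : ℕ) : (esOf V p ℓ).length = 2 ^ ℓ := by simp [esOf]

/-- The entries of `esOf ℓ`. [folklore] -/
theorem getElem_esOf {ℓ j : ℕ} (hj : j < (esOf V p ℓ).length) : (esOf V p ℓ)[j] = entryOf V p (2 ^ ℓ + j) := by
  simp [esOf]

/-- **The model tables are correctly certified**: `TableOK ℓ (esOf ℓ)`. [cite: ChenEtAl2022, §6 (Proof of Thm. 1.9, Claim 1: correctness of Solve by induction)] -/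
theorem tableOK_esOf (ℓ : ℕ) : TableOK V p ℓ (esOf V p ℓ) := by
  refine ⟨length_esOf ℓ, fun j hj => ?_⟩
  rw [getElem_esOf hj]
  by_cases h : Ext V p (2 ^ ℓ + j) []
  · refine ⟨true, _, by rw [entryOf, if_pos h], fun _ => validW_iterate_stepFn h (Nat.lt_succ_self _), fun h' => ?_⟩
    cases h'
  · refine ⟨false, [], by rw [entryOf, if_neg h], fun h' => ?_, fun _ w hw => h ⟨w, by simpa using hw⟩⟩
    cases h'

/-- Size of a model table: `|body (esOf ℓ)| ≤ 2^ℓ (2 p(2^{ℓ+1}) + 10)`. [folklore] -/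
theorem length_body_esOf_le (ℓ : ℕ) :
    (OracleCompose.body (esOf V p ℓ)).length ≤ 2 ^ ℓ * (2 * p.eval (2 ^ (ℓ + 1)) + 10) := by
  have h := length_body_le (esOf V p ℓ) (p.eval (2 ^ (ℓ + 1)) + 4) fun e he => by
    rw [esOf, List.mem_map] at he
    obtain ⟨j, hj, rfl⟩ := he
    rw [List.mem_range] at hj
    exact (length_entryOf_le _).trans (by
      have := TM2Iter.eval_mono p (show 2 ^ ℓ + j ≤ 2 ^ (ℓ + 1) by rw [pow_succ]; omega)
      omega)
  rw [length_esOf] at h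
  convert h using 2
  ring

/-! #### G2. Records and the oracle embedding -/

/-! Inner-loop records `⟨xi, ⟨ctr, u⟩⟩`, `xi = ⟨r, ⟨lv, ⟨Tab, nN⟩⟩⟩`: ruler, level `1^ℓ`, table, word `1ᴺ`. -/

/-- The inner record over the context `xi`, counter `c` and prefix `u`. [folklore] -/
def recI (r lv Tab nN c u : List Bool) : List Bool :=
  boolPair (boolPair r (boolPair lv (boolPair Tab nN))) (boolPair c u)

variable (D)

/-- `⟨r, lv, …⟩ ↦ 1^{canon D |lv|}` (capped by the ruler `r`): the canonical length of the table's level,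
from a record whose first field starts `⟨r, ⟨lv, …⟩⟩`. [folklore] -/
def canonLvF : List Bool → List Bool :=
  binToUnaryFn ∘ fanoutFn (nthF 0 ∘ fstF) (AvgNE.pow2NumF D ∘ fun z => (nthF 1 ∘ fstF) z ++ [true])

/-- `canonLvF D ∈ FP`. [folklore] -/
theorem canonLvF_mem_FP : canonLvF D ∈ FP :=
  comp_mem_FP binToUnaryFn_mem_FP (fanoutFn_mem_FP (comp_mem_FP (nthF_mem_FP 0) fstF_mem_FP)
    (comp_mem_FP (AvgNE.pow2NumF_mem_FP D) (append_mem_FP (comp_mem_FP (nthF_mem_FP 1) fstF_mem_FP) (const_mem_FP _))))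

variable {D}

/-- Value of `canonLvF` on a record `⟨⟨r, ⟨1^ℓ, t⟩⟩, s⟩` with a long enough ruler. [folklore] -/
theorem canonLvF_apply {r t s : List Bool} {ℓ : ℕ} (hr : canon D ℓ ≤ r.length) :
    canonLvF D (boolPair (boolPair r (boolPair (ones ℓ) t)) s) = ones (canon D ℓ) := by
  simp only [canonLvF, Function.comp_apply, fanoutFn_apply, nthF_zero, fstF_boolPair, nthF_succ_boolPair,
    binToUnaryFn_boolPair, AvgNE.bitsToNat_pow2NumF, List.length_append, List.length_replicate,
    List.length_singleton]
  rw [min_eq_left (by simpa [canon] using hr)]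
  rfl

variable (D)

/-- **The oracle embedding** of a query `q` computed by `qF`: `⟨Tab, ⟨q, 0^{canon - (2|Tab| + 2|q| + 4)}⟩⟩`,
the table `Tab` read by `tabF`. [cite: ChenEtAl2022, §6 (Proof of Thm. 1.9, Claim 1: "answer := L̄(t, w₀, …, x)")] -/
def embedF (tabF qF : List Bool → List Bool) : List Bool → List Bool :=
  fanoutFn tabF (fanoutFn qF (Kannan.zerosFn ∘ dropFn ∘
    fanoutFn (fanoutFn tabF (fanoutFn qF fun _ => [])) (canonLvF D)))

variable {D}

/-- `embedF D tabF qF ∈ FP`. [folklore] -/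
theorem embedF_mem_FP {tabF qF : List Bool → List Bool} (ht : tabF ∈ FP) (hq : qF ∈ FP) : embedF D tabF qF ∈ FP :=
  fanoutFn_mem_FP ht (fanoutFn_mem_FP hq (comp_mem_FP Kannan.zerosFn_mem_FP (comp_mem_FP dropFn_mem_FP
    (fanoutFn_mem_FP (fanoutFn_mem_FP ht (fanoutFn_mem_FP hq (const_mem_FP _))) (canonLvF_mem_FP D)))))

/-- **Value of the embedding**: if `canonLvF` reads `1ᶜ`, the embedding is `⟨Tab, ⟨q, 0…0⟩⟩` padded
towards length `c`. [folklore] -/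
theorem embedF_apply {tabF qF : List Bool → List Bool} {z : List Bool} {c : ℕ} (hc : canonLvF D z = ones c) :
    embedF D tabF qF z = boolPair (tabF z) (boolPair (qF z)
      (List.replicate (c - (2 * (tabF z).length + 2 * (qF z).length + 4)) false)) := by
  have hpad : (Kannan.zerosFn ∘ dropFn ∘ fanoutFn (fanoutFn tabF (fanoutFn qF fun _ => [])) (canonLvF D)) z =
      List.replicate (c - (2 * (tabF z).length + 2 * (qF z).length + 4)) false := by
    simp only [Function.comp_apply, fanoutFn_apply, hc, dropFn_boolPair, Kannan.zerosFn_apply, List.length_drop,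
      List.length_replicate, length_boolPair, List.length_nil]
    congr 1
    omega
  rw [embedF, fanoutFn_apply, fanoutFn_apply, hpad]

/-- **Length of the embedding**: exactly `c` when the content fits. [folklore] -/
theorem length_embedF {tabF qF : List Bool → List Bool} {z : List Bool} {c : ℕ} (hc : canonLvF D z = ones c)
    (hfit : 2 * (tabF z).length + 2 * (qF z).length + 4 ≤ c) : (embedF D tabF qF z).length = c := by
  rw [embedF_apply hc]
  simp only [length_boolPair, List.length_replicate]
  omega

/-! #### G3. The inner loop: prefix search -/

/-- Accessors of the inner record: the word `1ᴺ` (`nN`), the table, the prefix. [folklore] -/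
def nNI : List Bool → List Bool := sndPow 2 ∘ fstF
/-- See `nNI`. [folklore] -/
def tabI : List Bool → List Bool := nthF 2 ∘ fstF
/-- See `nNI`. [folklore] -/
def uI : List Bool → List Bool := sndPow 1

/-- The query "does `u b` extend?" of the inner record. [folklore] -/
def qI (b : Bool) : List Bool → List Bool := fanoutFn nNI fun z => uI z ++ [b]

/-- `nNI, tabI, uI, qI b ∈ FP`. [folklore] -/
theorem qI_mem_FP (b : Bool) : nNI ∈ FP ∧ tabI ∈ FP ∧ uI ∈ FP ∧ qI b ∈ FP :=
  ⟨comp_mem_FP (sndPow_mem_FP 2) fstF_mem_FP, comp_mem_FP (nthF_mem_FP 2) fstF_mem_FP, sndPow_mem_FP 1,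
    fanoutFn_mem_FP (comp_mem_FP (sndPow_mem_FP 2) fstF_mem_FP) (append_mem_FP (sndPow_mem_FP 1) (const_mem_FP _))⟩

/-- Value of `nNI` on an inner record. [folklore] -/
@[simp] theorem nNI_recI (r lv Tab nN c u : List Bool) : nNI (recI r lv Tab nN c u) = nN := by
  simp [nNI, recI, sndPow]

/-- Value of `tabI` on an inner record. [folklore] -/
@[simp] theorem tabI_recI (r lv Tab nN c u : List Bool) : tabI (recI r lv Tab nN c u) = Tab := by
  simp [tabI, recI, nthF]

/-- Value of `uI` on an inner record. [folklore] -/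
@[simp] theorem uI_recI (r lv Tab nN c u : List Bool) : uI (recI r lv Tab nN c u) = u := by
  simp [uI, recI, sndPow]

/-- Value of `qI b` on an inner record. [folklore] -/
@[simp] theorem qI_recI (r lv Tab nN c u : List Bool) (b : Bool) :
    qI b (recI r lv Tab nN c u) = boolPair nN (u ++ [b]) := by
  simp [qI]

variable (D O)

/-- The test "`u b` extends", asked to the oracle `O` on the embedded query. [folklore] -/
def SI (b : Bool) : Language Bool := embedF D tabI (qI b) ⁻¹' O

/-- **The body of the inner loop**: one step of the prefix search, the two extension questions being
put to the oracle. [cite: ChenEtAl2022, §6 (Proof of Thm. 1.9, Claim 1)] -/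
def bodyI : List Bool → List Bool :=
  OracleCompose.condFn (SI D O false) (fun z => uI z ++ [false])
    (OracleCompose.condFn (SI D O true) (fun z => uI z ++ [true]) uI)

variable {D O}

/-- `bodyI ∈ FP` when the oracle is in `P`. [cite: AroraBarak2009, §1.3] -/
theorem bodyI_mem_FP (hO : O ∈ Classes.P) : bodyI D O ∈ FP := by
  have hS : ∀ b, SI D O b ∈ Classes.P := fun b =>
    preimage_mem_P hO (embedF_mem_FP (qI_mem_FP b).2.1 (qI_mem_FP b).2.2.2)
  exact OracleCompose.condFn_mem_FP (hS false) (append_mem_FP (sndPow_mem_FP 1) (const_mem_FP _))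
    (OracleCompose.condFn_mem_FP (hS true) (append_mem_FP (sndPow_mem_FP 1) (const_mem_FP _)) (sndPow_mem_FP 1))

/-- The inner body grows the state by at most one symbol, on every input. [folklore] -/
theorem length_bodyI_le (z : List Bool) : (bodyI D O z).length ≤ (sndPow 1 z).length + 1 * ((fstF z).length + 1) := by
  unfold bodyI
  rw [OracleCompose.condFn_apply, OracleCompose.condFn_apply]
  split_ifs <;> simp [uI]

variable (p D O) in
/-- **The inner loop** `z ↦ (loopStep bodyI)^{(p+1)(|fstF z|)} z`. [folklore] -/
def loopI : List Bool → List Bool := fun z => (loopStep (bodyI D O))^[(p + 1).eval (fstF z).length] z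

/-- `loopI ∈ FP` when the oracle is in `P` (`Brick.loopFn_mem_FP`). [cite: AroraBarak2009, §1.3 (bounded loops)] -/
theorem loopI_mem_FP (hO : O ∈ Classes.P) : loopI p D O ∈ FP :=
  loopFn_mem_FP (bodyI_mem_FP hO) length_bodyI_le (p + 1)

/-- **The oracle hypothesis**: on a correctly certified table of level `ℓ` padded to the canonical length,
membership in `O` is membership of the query in `Hq` — property (S2) of `B`. [folklore] -/
def OracleOK (V : Language Bool) (p : Polynomial ℕ) (D : ℕ) (O : Language Bool) : Prop :=
  ∀ (ℓ : ℕ) (es : List (List Bool)) (s pad : List Bool), TableOK V p ℓ es →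
    (boolPair (OracleCompose.body es) (boolPair s pad)).length = canon D ℓ →
    (boolPair (OracleCompose.body es) (boolPair s pad) ∈ O ↔ s ∈ Hq V p)

/-- The size hypothesis of one oracle call: the query fits next to the table. [folklore] -/
def Fits (D ℓ : ℕ) (Tab q : List Bool) : Prop := 2 * Tab.length + 2 * q.length + 4 ≤ canon D ℓ

/-- **One oracle call answers one `Hq` question.** [cite: ChenEtAl2022, §6 (Proof of Thm. 1.9, Claim 1)] -/
theorem mem_SI_iff (hO : OracleOK V p D O) {ℓ : ℕ} {es : List (List Bool)} (hes : TableOK V p ℓ es)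
    {r nN c u : List Bool} (hr : canon D ℓ ≤ r.length) (b : Bool)
    (hfit : Fits D ℓ (OracleCompose.body es) (boolPair nN (u ++ [b]))) :
    recI r (ones ℓ) (OracleCompose.body es) nN c u ∈ SI D O b ↔ Ext V p nN.length (u ++ [b]) := by
  rw [SI, memL_preimage]
  have hc : canonLvF D (recI r (ones ℓ) (OracleCompose.body es) nN c u) = ones (canon D ℓ) := canonLvF_apply hr
  have hfit' : 2 * (tabI (recI r (ones ℓ) (OracleCompose.body es) nN c u)).length +
      2 * (qI b (recI r (ones ℓ) (OracleCompose.body es) nN c u)).length + 4 ≤ canon D ℓ := by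
    rw [tabI_recI, qI_recI]; exact hfit
  have hval := embedF_apply (tabF := tabI) (qF := qI b) hc
  have hlen := length_embedF (tabF := tabI) (qF := qI b) hc hfit'
  rw [hval] at hlen ⊢
  simp only [tabI_recI, qI_recI] at hlen ⊢
  rw [hO ℓ es _ _ hes hlen]
  change (∃ v, ValidW V p (fstF (boolPair nN (u ++ [b]))).length (sndF (boolPair nN (u ++ [b])) ++ v)) ↔ _
  simp only [fstF_boolPair, sndF_boolPair, List.append_assoc, List.singleton_append, Ext]

/-- **The inner body is one step of the prefix search** (on a well-formed record whose queries fit).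
[cite: ChenEtAl2022, §6 (Proof of Thm. 1.9, Claim 1)] -/
theorem bodyI_recI (hO : OracleOK V p D O) {ℓ : ℕ} {es : List (List Bool)} (hes : TableOK V p ℓ es)
    {r c u : List Bool} {N : ℕ} (hr : canon D ℓ ≤ r.length)
    (hfit : ∀ b, Fits D ℓ (OracleCompose.body es) (boolPair (ones N) (u ++ [b]))) :
    bodyI D O (recI r (ones ℓ) (OracleCompose.body es) (ones N) c u) = stepFn V p N u := by
  have h0 := mem_SI_iff hO hes hr false (nN := ones N) (c := c) (hfit false)
  have h1 := mem_SI_iff hO hes hr true (nN := ones N) (c := c) (hfit true)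
  simp only [List.length_replicate] at h0 h1
  unfold bodyI stepFn
  rw [OracleCompose.condFn_apply, OracleCompose.condFn_apply]
  by_cases e0 : Ext V p N (u ++ [false])
  · rw [if_pos (h0.2 e0), if_pos e0, uI_recI]
  · rw [if_neg (fun h => e0 (h0.1 h)), if_neg e0]
    by_cases e1 : Ext V p N (u ++ [true])
    · rw [if_pos (h1.2 e1), if_pos e1, uI_recI]
    · rw [if_neg (fun h => e1 (h1.1 h)), if_neg e1, uI_recI]

/-- **Semantics of the inner loop**: `K` rounds from a prefix `u` of length `≤ K₀ - K` are `K` steps of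
the prefix search, provided queries of prefixes of length `≤ K₀ + 1` fit. [cite: ChenEtAl2022, §6 (Proof of Thm. 1.9, Claim 1)] -/
theorem loopModel_bodyI (hO : OracleOK V p D O) {ℓ : ℕ} {es : List (List Bool)} (hes : TableOK V p ℓ es)
    {r : List Bool} {N K₀ : ℕ} (hr : canon D ℓ ≤ r.length)
    (hfit : ∀ q : List Bool, q.length ≤ 2 * N + 2 + (K₀ + 1) → Fits D ℓ (OracleCompose.body es) q) :
    ∀ (K : ℕ) (u : List Bool), u.length + K ≤ K₀ →
      loopModel (bodyI D O) (boolPair r (boolPair (ones ℓ) (boolPair (OracleCompose.body es) (ones N)))) K u =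
        (stepFn V p N)^[K] u
  | 0, u, _ => rfl
  | K + 1, u, hu => by
    rw [loopModel, Function.iterate_succ_apply]
    have hb := bodyI_recI hO hes hr (c := encodeNat (K + 1)) (u := u) (N := N) fun b => hfit _ (by
      simp only [length_boolPair, List.length_replicate, List.length_append, List.length_singleton]; omega)
    rw [recI] at hb
    rw [hb]
    exact loopModel_bodyI hO hes hr hfit K _ (by have := length_stepFn_le (V := V) (p := p) N u; omega)

end Search

end NoRefuter

end Literature.Computability.MetaComplexity
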